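import Summits.BirchSwinnertonDyer.BirchSwinnertonDyer.Theorems.KolyvaginDepthDoorDepthTableKurihara
import Summits.BirchSwinnertonDyer.BirchSwinnertonDyer.Theorems.KolyvaginDepthDoorDepthTableSteinWuthrichRows2
import Summits.BirchSwinnertonDyer.BirchSwinnertonDyer.Theorems.KolyvaginDepthDoorDepthTableRankTwo718b1TwistBSDQuotientUniform
import Summits.BirchSwinnertonDyer.BirchSwinnertonDyer.Theorems.KolyvaginDepthDoorDepthTableSteinWuthrichRows8
import Summits.BirchSwinnertonDyer.BirchSwinnertonDyer.Theorems.KolyvaginDepthDoorDepthTableRankTwo794a1TwistBSDQuotientUniform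
import Summits.BirchSwinnertonDyer.BirchSwinnertonDyer.Theorems.KolyvaginDepthDoorDepthTableSteinWuthrichRows9
import Summits.BirchSwinnertonDyer.BirchSwinnertonDyer.Theorems.KolyvaginDepthDoorDepthTableRowsIntrinsic4
import Summits.BirchSwinnertonDyer.Rank1Residual.Supersingular.CountPointsFast
import Summits.BirchSwinnertonDyer.Rank1Residual.Additive.X4ThreeKuriharaCertKernel
import HarnessLib

/-!
# Route `KolyvaginDepthDoor`, crux `KolyvaginDepthSupplyKN` (stmt-BirchSwinnertonDyer-22820) —
# DEPTH TABLE v17, E-SIDE TABLE (part 4: `718b1`, `794a1`, `997b1`): `Ш(E/ℚ)[p] = 0` at an admissible `p ∈ {7, 11}` from the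
# TREE'S OWN Kurihara records (Kim 2026 Thm. 1.11 by name) — the curves of the table that are anomalous or non-cyclic at `5`

Helper file of the lead prover of line `levelone` (kdd-p1 g21; `--supports stmt-BirchSwinnertonDyer-22820
--as helper`); it closes nothing and BSD is NOT proved by it.

Sequel of `KolyvaginDepthDoorDepthTableKuriharaESideFive1/2`. For the curves below `5` is unusable for Kim's Thm. 1.11 (`a_5 ≡ 1
(mod 5)` — hypothesis (iii) —, or the record's level at `5` has a prime with `25 ∣ #Ẽ(𝔽_ℓ)`), but the tree ALSO holds their
Kurihara records at `p ∈ {7, 11, 13}` (`ν = 2`); at the prime used here every hypothesis is decided in the kernel: `p` good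
ordinary and non-anomalous, `ρ̄_{E,p}` onto (semistable + Mazur's Frobenius no-root witness, Serre Prop. 21), the level
`ℓ₁ℓ₂ ∈ 𝒩₁(E, p)` with cyclic `p`-parts (`countPointsFast`), Kodaira–Néron at `p` (lineage `kodairaNeron_of_five_le`),
`2 ≤ rank_ℤ E(ℚ)` (observatory kernel certificates):

* `718b1` = `[1, 0, 1, -5, 0]` at `p = 7`: record `(7, 491·617 = 302947, 2, 5)` (`RecordsN000718to000747`); `#Ẽ(𝔽_491) = 462`, `#Ẽ(𝔽_617) = 658`; `a_7 = -5`; surjectivity witness `a_3 = -2`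
* `794a1` = `[1, 0, 1, -3, 2]` at `p = 7`: record `(7, 197·281 = 55357, 2, 5)` (`RecordsN000786to000815`); `#Ẽ(𝔽_197) = 210`, `#Ẽ(𝔽_281) = 287`; `a_7 = -3`; surjectivity witness `a_3 = -2`
* `997b1` = `[0, -1, 1, -5, -3]` at `p = 7`: record `(7, 29·113 = 3277, 2, 3)` (`RecordsN000988to000999`); `#Ẽ(𝔽_29) = 28`, `#Ẽ(𝔽_113) = 112`; `a_7 = -2`; surjectivity witness `a_5 = -4`

RESULT per curve (`C<label>.sha_inf_torsionBy_eq_bot_of_kuriharaClaim_<p>`): `Ш(E/ℚ)[p] = 0` — X1 at `p`, torsion level —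
CONDITIONAL on Kim 2026 Thm. 1.11, modularity, Mazur 1978 Cor. 4.1 BY NAME and the record's CLAIM (`hδ`, read at level `N_E`
through `KuriharaCertificates.Record.Claim`). With the `p = 5` files and the `389a1`/`433a1` row files the `E`-side conjunct of
the depth table is certificate-backed for 17 of the 18 rank-two curves of conductor `≤ 1000` (`664a1`, additive at `2`, would
need Serre Prop. 19 witnesses). Per curve; nothing class-wide; BSD is NOT proved by any of this.

References: [Kim2022StructureSelmer] Thm. 1.11; [Mazur1978] Cor. 4.1, Prop. 6.3 (1); [Serre1972] Prop. 21; [SilvermanAEC2009] VII.3.1.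
-/

set_option linter.dupNamespace false

noncomputable section

open scoped Classical NumberField

namespace Summit.BirchSwinnertonDyer.BirchSwinnertonDyer.Theorems.KolyvaginDepthDoor

open Literature.NumberTheory.EllipticCurves Literature.NumberTheory.EllipticCurves.ModularForms
  WeierstrassCurve NumberField IsDedekindDomain
open Summit.BirchSwinnertonDyer.BirchSwinnertonDyer.Theorems
open Summit.BirchSwinnertonDyer.BirchSwinnertonDyer.Rank2Observatory
open Summit.BirchSwinnertonDyer.BirchSwinnertonDyer.Rank1Residual (IntModel.frobeniusTrace_eq)
open Summit.BirchSwinnertonDyer.Rank1Residual.Supersingular (natCard_point_eq_of_countPoints countPoints_eq_of_fast)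
open Summit.BirchSwinnertonDyer.Rank1Residual.Additive (card_torsion_le_of_intModel_of_card
  isKolyvaginPrime_of_intModel_of_card isKolyvaginProduct_mul)

/-! ## `718b1` = `[1, 0, 1, -5, 0]` at `p = 7`: record `cert_718b1` @ `(7, 491·617)`, `δ̃ ≡ 5` -/

namespace C718b1

/-- `#Ẽ(𝔽_7) = 13` for `718b1` (`a_7 = -5`: good ordinary, non-anomalous at `7`), kernel-decided (`countPointsFast`). [cite: CremonaAlgorithms1997, Table 1 (718b1)] -/
theorem card_7 :
    Nat.card (((⟨1, 0, 1, -5, 0⟩ : WeierstrassCurve ℤ).map (Int.castRingHom (ZMod 7))).toAffine.Point) = 13 :=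
  haveI : Fact (Nat.Prime 7) := ⟨by norm_num⟩
  natCard_point_eq_of_countPoints 1 0 1 (-5) 0 7 (by norm_num) (by decide +kernel) (n := 13)
    (countPoints_eq_of_fast (by decide +kernel))

/-- `#Ẽ(𝔽_491) = 462` for `718b1` (`491 ≡ 1`, `a_491 = 30 ≡ 2 (mod 7)`, `7² ∤ 462`), kernel-decided (`countPointsFast`). [cite: CremonaAlgorithms1997, Table 1 (718b1)] -/
theorem card_491 :
    Nat.card (((⟨1, 0, 1, -5, 0⟩ : WeierstrassCurve ℤ).map (Int.castRingHom (ZMod 491))).toAffine.Point) = 462 :=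
  haveI : Fact (Nat.Prime 491) := ⟨by norm_num⟩
  natCard_point_eq_of_countPoints 1 0 1 (-5) 0 491 (by norm_num) (by decide +kernel) (n := 462)
    (countPoints_eq_of_fast (by decide +kernel))

/-- `#Ẽ(𝔽_617) = 658` for `718b1` (`617 ≡ 1`, `a_617 = -40 ≡ 2 (mod 7)`, `7² ∤ 658`), kernel-decided (`countPointsFast`). [cite: CremonaAlgorithms1997, Table 1 (718b1)] -/
theorem card_617 :
    Nat.card (((⟨1, 0, 1, -5, 0⟩ : WeierstrassCurve ℤ).map (Int.castRingHom (ZMod 617))).toAffine.Point) = 658 :=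
  haveI : Fact (Nat.Prime 617) := ⟨by norm_num⟩
  natCard_point_eq_of_countPoints 1 0 1 (-5) 0 617 (by norm_num) (by decide +kernel) (n := 658)
    (countPoints_eq_of_fast (by decide +kernel))

/-- **`7` is good ordinary for `718b1`** (`7 ∤ Δ`, `a_7 = -5`). [cite: CremonaAlgorithms1997, Table 1 (718b1)] -/
theorem goodOrdinary_7 :
    haveI := Fact.mk (by norm_num : Nat.Prime 7); haveI := isGloballyMinimal_c718b1;
    ((⟨1, 0, 1, -5, 0⟩ : WeierstrassCurve ℤ).map (Int.castRingHom ℚ)).HasGoodReductionAtPrime 7 ∧ ¬ ((7 : ℕ) : ℤ) ∣ ((⟨1, 0, 1, -5, 0⟩ : WeierstrassCurve ℤ).map (Int.castRingHom ℚ)).frobeniusTrace 7 := by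
  haveI := Fact.mk (by norm_num : Nat.Prime 7)
  haveI := isElliptic_c718b1
  haveI := isGloballyMinimal_c718b1
  exact goodOrdinary_of_intModel_certificate intModel 7 (by decide +kernel) (n := 13) card_7 (by decide +kernel)

/-- **`ρ̄_{E,7}` is surjective for `718b1`**: semistable (`gcd(c₄, Δ) = 1`) and `X² − (-2)X + 3` (`a_3 = -2`) has no root
mod `7` (Mazur Prop. 6.3 (1) ⟹ `E[7]` irreducible; Serre Prop. 21 ⟹ onto). [cite: Serre1972, §5.4 Prop. 21] [cite: Mazur1978, §6 Prop. 6.3 (1)] -/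
theorem hasSurjectiveModNGaloisRep_7 :
    haveI := isElliptic_c718b1;
    ((⟨1, 0, 1, -5, 0⟩ : WeierstrassCurve ℤ).map (Int.castRingHom ℚ)).HasSurjectiveModNGaloisRep (7 : ℕ) := by
  have hn : ∀ t : ZMod 7, t ^ 2 - (((3 : ℕ) : ℤ) + 1 - (6 : ℕ) : ℤ) * t + ((3 : ℕ) : ZMod 7) ≠ 0 := by
    decide +kernel
  haveI := Fact.mk (by norm_num : Nat.Prime 7); haveI := Fact.mk (by norm_num : Nat.Prime 3)
  haveI := isElliptic_c718b1; haveI := isGloballyMinimal_c718b1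
  exact hasSurjectiveModNGaloisRep_of_intModel_certificate intModel
    (by rw [Int.isCoprime_iff_gcd_eq_one]; decide +kernel) 7 3 (by norm_num) (by decide +kernel)
    (n := 6) card_3 hn

/-- **`7` is non-anomalous for `718b1`**: `a_7 − 1 = -6`. [cite: SilvermanAEC2009, VII.3 Prop. 3.1] -/
theorem nonAnomalous_7 :
    haveI := isGloballyMinimal_c718b1; haveI := Fact.mk (by norm_num : Nat.Prime 7);
    ¬ ((7 : ℕ) : ℤ) ∣ ((⟨1, 0, 1, -5, 0⟩ : WeierstrassCurve ℤ).map (Int.castRingHom ℚ)).frobeniusTrace 7 - 1 := by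
  haveI := isElliptic_c718b1; haveI := isGloballyMinimal_c718b1; haveI := Fact.mk (by norm_num : Nat.Prime 7)
  rw [IntModel.frobeniusTrace_eq intModel card_7]
  decide

/-- **`302947 = 491·617` is a cyclic Kolyvagin level for `(718b1, 7)`** — the level of the tree record `cert_718b1` at `p = 7`.
[cite: Kim2022StructureSelmer, §1.2.2 (PDF p. 5)] -/
theorem isCyclicKolyvaginLevel_7_302947 :
    haveI := isGloballyMinimal_c718b1; haveI := Fact.mk (by norm_num : Nat.Prime 7);
    IsCyclicKolyvaginLevel ((⟨1, 0, 1, -5, 0⟩ : WeierstrassCurve ℤ).map (Int.castRingHom ℚ)) 7 302947 := by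
  haveI := isElliptic_c718b1
  haveI := isGloballyMinimal_c718b1
  haveI := Fact.mk (by norm_num : Nat.Prime 7)
  haveI : Fact (Nat.Prime 491) := ⟨by norm_num⟩
  haveI : Fact (Nat.Prime 617) := ⟨by norm_num⟩
  have h₁ : Kato.IsKolyvaginPrime ((⟨1, 0, 1, -5, 0⟩ : WeierstrassCurve ℤ).map (Int.castRingHom ℚ)) 7 1 491 :=
    isKolyvaginPrime_of_intModel_of_card intModel 7 1 491 (by norm_num) (by decide +kernel) (by decide) card_491
      (by norm_num)
  have h₂ : Kato.IsKolyvaginPrime ((⟨1, 0, 1, -5, 0⟩ : WeierstrassCurve ℤ).map (Int.castRingHom ℚ)) 7 1 617 :=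
    isKolyvaginPrime_of_intModel_of_card intModel 7 1 617 (by norm_num) (by decide +kernel) (by decide) card_617
      (by norm_num)
  refine ⟨by simpa using isKolyvaginProduct_mul h₁ h₂ (by norm_num), fun ℓ hℓ hdvd ↦ ?_⟩
  rw [show (302947 : ℕ) = 491 * 617 from rfl] at hdvd
  rcases (Nat.Prime.dvd_mul hℓ.out).mp hdvd with h | h
  · obtain rfl := (Nat.prime_dvd_prime_iff_eq hℓ.out (by norm_num)).mp h
    exact card_torsion_le_of_intModel_of_card intModel 7 491 card_491 (by norm_num)
  · obtain rfl := (Nat.prime_dvd_prime_iff_eq hℓ.out (by norm_num)).mp h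
    exact card_torsion_le_of_intModel_of_card intModel 7 617 card_617 (by norm_num)

/-- **`Ш(718b1/ℚ)[7] = 0` FROM THE TREE RECORD `cert_718b1` @ `(7, 491·617)`** (Kurihara currency): granted Kim 2026 Thm. 1.11
(`hKim`), modularity (`hnf`), Mazur 1978 Cor. 4.1 (`hMaz`) BY NAME and the record's CLAIM `hδ` (read at level `N_E` through
`KuriharaCertificates.Record.Claim`), `#Sel_7(E/ℚ) ≤ 7² = 7^rank` and so `Ш(E/ℚ)[7] = 0` (`7` good ordinary `goodOrdinary_7`,
`ρ̄_{E,7}` onto `hasSurjectiveModNGaloisRep_7`, `nonAnomalous_7`, Kodaira–Néron `kodairaNeron_of_five_le 7`, `2 ≤ rank` `KernelCerts002.C718b1.two_le_rank`).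
CONDITIONAL on the three named facts and the claim; per curve; BSD is not proved by it.
[cite: Kim2022StructureSelmer, Thm. 1.11 (PDF p. 8)] [cite: Mazur1978, Cor. 4.1] [cite: CremonaAlgorithms1997, Table 1 (718b1)] -/
theorem sha_inf_torsionBy_eq_bot_of_kuriharaClaim_7
    (hKim : Kim2022_card_selmerGroup_le_pow_of_kuriharaNumber_ne_zero)
    (hnf : exists_isNewformOf) (hMaz : mazur_not_dvd_maninConstant_of_odd)
    (hδ : haveI := isElliptic_c718b1; haveI := isGloballyMinimal_c718b1;
      haveI : NeZero (((⟨1, 0, 1, -5, 0⟩ : WeierstrassCurve ℤ).map (Int.castRingHom ℚ)).conductorNorm ℤ) := neZero_conductorNorm_of_isElliptic _;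
      haveI := Fact.mk (by norm_num : Nat.Prime 7);
      ∀ (D : ModularParametrizationData ((⟨1, 0, 1, -5, 0⟩ : WeierstrassCurve ℤ).map (Int.castRingHom ℚ)) (((⟨1, 0, 1, -5, 0⟩ : WeierstrassCurve ℤ).map (Int.castRingHom ℚ)).conductorNorm ℤ)), ¬ ((7 : ℕ) : ℤ) ∣ D.maninConstant →
        (∃ u : ℚ, ‖(u : ℚ_[7])‖ = 1 ∧ ((⟨1, 0, 1, -5, 0⟩ : WeierstrassCurve ℤ).map (Int.castRingHom ℚ)).realPeriodRat = u * plusPeriod D.f) →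
        ∃ ψ : (ℓ : ℕ) → (ZMod ℓ)ˣ →* Multiplicative (ZMod 7),
          (∀ ℓ ∈ (302947 : ℕ).primeFactors, Function.Surjective (ψ ℓ)) ∧ kuriharaNumber D.f 7 302947 ψ ≠ 0) :
    haveI := isElliptic_c718b1; haveI := isGloballyMinimal_c718b1; haveI := Fact.mk (by norm_num : Nat.Prime 7);
    (((⟨1, 0, 1, -5, 0⟩ : WeierstrassCurve ℤ).map (Int.castRingHom ℚ)).sha ⊓ AddSubgroup.torsionBy ((⟨1, 0, 1, -5, 0⟩ : WeierstrassCurve ℤ).map (Int.castRingHom ℚ)).galH1 ((7 : ℕ) : ℤ) : AddSubgroup _) = ⊥ := by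
  haveI := isElliptic_c718b1
  haveI := isGloballyMinimal_c718b1
  haveI iNZ : NeZero (((⟨1, 0, 1, -5, 0⟩ : WeierstrassCurve ℤ).map (Int.castRingHom ℚ)).conductorNorm ℤ) := neZero_conductorNorm_of_isElliptic _
  haveI := Fact.mk (by norm_num : Nat.Prime 7)
  haveI : NeZero (302947 : ℕ) := ⟨by norm_num⟩
  have hν : (302947 : ℕ).primeFactors.card ≤ ((⟨1, 0, 1, -5, 0⟩ : WeierstrassCurve ℤ).map (Int.castRingHom ℚ)).mordellWeilRank := by
    refine le_trans (le_of_eq ?_) KernelCerts002.C718b1.two_le_rank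
    rw [show (302947 : ℕ) = 491 * 617 from rfl, Nat.primeFactors_mul (by norm_num) (by norm_num),
      Nat.Prime.primeFactors (by norm_num), Nat.Prime.primeFactors (by norm_num)]
    decide
  exact sha_inf_torsionBy_eq_bot_of_kuriharaClaim hKim hnf hMaz _ 7 (by norm_num) goodOrdinary_7.1 goodOrdinary_7.2
    hasSurjectiveModNGaloisRep_7 nonAnomalous_7 (kodairaNeron_of_five_le 7 (by norm_num)) 302947 isCyclicKolyvaginLevel_7_302947 hν hδ

end C718b1

/-! ## `794a1` = `[1, 0, 1, -3, 2]` at `p = 7`: record `cert_794a1` @ `(7, 197·281)`, `δ̃ ≡ 5` -/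

namespace C794a1

/-- `#Ẽ(𝔽_7) = 11` for `794a1` (`a_7 = -3`: good ordinary, non-anomalous at `7`), kernel-decided (`countPointsFast`). [cite: CremonaAlgorithms1997, Table 1 (794a1)] -/
theorem card_7 :
    Nat.card (((⟨1, 0, 1, -3, 2⟩ : WeierstrassCurve ℤ).map (Int.castRingHom (ZMod 7))).toAffine.Point) = 11 :=
  haveI : Fact (Nat.Prime 7) := ⟨by norm_num⟩
  natCard_point_eq_of_countPoints 1 0 1 (-3) 2 7 (by norm_num) (by decide +kernel) (n := 11)
    (countPoints_eq_of_fast (by decide +kernel))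

/-- `#Ẽ(𝔽_197) = 210` for `794a1` (`197 ≡ 1`, `a_197 = -12 ≡ 2 (mod 7)`, `7² ∤ 210`), kernel-decided (`countPointsFast`). [cite: CremonaAlgorithms1997, Table 1 (794a1)] -/
theorem card_197 :
    Nat.card (((⟨1, 0, 1, -3, 2⟩ : WeierstrassCurve ℤ).map (Int.castRingHom (ZMod 197))).toAffine.Point) = 210 :=
  haveI : Fact (Nat.Prime 197) := ⟨by norm_num⟩
  natCard_point_eq_of_countPoints 1 0 1 (-3) 2 197 (by norm_num) (by decide +kernel) (n := 210)
    (countPoints_eq_of_fast (by decide +kernel))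

/-- `#Ẽ(𝔽_281) = 287` for `794a1` (`281 ≡ 1`, `a_281 = -5 ≡ 2 (mod 7)`, `7² ∤ 287`), kernel-decided (`countPointsFast`). [cite: CremonaAlgorithms1997, Table 1 (794a1)] -/
theorem card_281 :
    Nat.card (((⟨1, 0, 1, -3, 2⟩ : WeierstrassCurve ℤ).map (Int.castRingHom (ZMod 281))).toAffine.Point) = 287 :=
  haveI : Fact (Nat.Prime 281) := ⟨by norm_num⟩
  natCard_point_eq_of_countPoints 1 0 1 (-3) 2 281 (by norm_num) (by decide +kernel) (n := 287)
    (countPoints_eq_of_fast (by decide +kernel))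

/-- **`7` is good ordinary for `794a1`** (`7 ∤ Δ`, `a_7 = -3`). [cite: CremonaAlgorithms1997, Table 1 (794a1)] -/
theorem goodOrdinary_7 :
    haveI := Fact.mk (by norm_num : Nat.Prime 7); haveI := isGloballyMinimal_c794a1;
    ((⟨1, 0, 1, -3, 2⟩ : WeierstrassCurve ℤ).map (Int.castRingHom ℚ)).HasGoodReductionAtPrime 7 ∧ ¬ ((7 : ℕ) : ℤ) ∣ ((⟨1, 0, 1, -3, 2⟩ : WeierstrassCurve ℤ).map (Int.castRingHom ℚ)).frobeniusTrace 7 := by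
  haveI := Fact.mk (by norm_num : Nat.Prime 7)
  haveI := isElliptic_c794a1
  haveI := isGloballyMinimal_c794a1
  exact goodOrdinary_of_intModel_certificate intModel 7 (by decide +kernel) (n := 11) card_7 (by decide +kernel)

/-- **`ρ̄_{E,7}` is surjective for `794a1`**: semistable (`gcd(c₄, Δ) = 1`) and `X² − (-2)X + 3` (`a_3 = -2`) has no root
mod `7` (Mazur Prop. 6.3 (1) ⟹ `E[7]` irreducible; Serre Prop. 21 ⟹ onto). [cite: Serre1972, §5.4 Prop. 21] [cite: Mazur1978, §6 Prop. 6.3 (1)] -/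
theorem hasSurjectiveModNGaloisRep_7 :
    haveI := isElliptic_c794a1;
    ((⟨1, 0, 1, -3, 2⟩ : WeierstrassCurve ℤ).map (Int.castRingHom ℚ)).HasSurjectiveModNGaloisRep (7 : ℕ) := by
  have hn : ∀ t : ZMod 7, t ^ 2 - (((3 : ℕ) : ℤ) + 1 - (6 : ℕ) : ℤ) * t + ((3 : ℕ) : ZMod 7) ≠ 0 := by
    decide +kernel
  haveI := Fact.mk (by norm_num : Nat.Prime 7); haveI := Fact.mk (by norm_num : Nat.Prime 3)
  haveI := isElliptic_c794a1; haveI := isGloballyMinimal_c794a1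
  exact hasSurjectiveModNGaloisRep_of_intModel_certificate intModel
    (by rw [Int.isCoprime_iff_gcd_eq_one]; decide +kernel) 7 3 (by norm_num) (by decide +kernel)
    (n := 6) card_3 hn

/-- **`7` is non-anomalous for `794a1`**: `a_7 − 1 = -4`. [cite: SilvermanAEC2009, VII.3 Prop. 3.1] -/
theorem nonAnomalous_7 :
    haveI := isGloballyMinimal_c794a1; haveI := Fact.mk (by norm_num : Nat.Prime 7);
    ¬ ((7 : ℕ) : ℤ) ∣ ((⟨1, 0, 1, -3, 2⟩ : WeierstrassCurve ℤ).map (Int.castRingHom ℚ)).frobeniusTrace 7 - 1 := by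
  haveI := isElliptic_c794a1; haveI := isGloballyMinimal_c794a1; haveI := Fact.mk (by norm_num : Nat.Prime 7)
  rw [IntModel.frobeniusTrace_eq intModel card_7]
  decide

/-- **`55357 = 197·281` is a cyclic Kolyvagin level for `(794a1, 7)`** — the level of the tree record `cert_794a1` at `p = 7`.
[cite: Kim2022StructureSelmer, §1.2.2 (PDF p. 5)] -/
theorem isCyclicKolyvaginLevel_7_55357 :
    haveI := isGloballyMinimal_c794a1; haveI := Fact.mk (by norm_num : Nat.Prime 7);
    IsCyclicKolyvaginLevel ((⟨1, 0, 1, -3, 2⟩ : WeierstrassCurve ℤ).map (Int.castRingHom ℚ)) 7 55357 := by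
  haveI := isElliptic_c794a1
  haveI := isGloballyMinimal_c794a1
  haveI := Fact.mk (by norm_num : Nat.Prime 7)
  haveI : Fact (Nat.Prime 197) := ⟨by norm_num⟩
  haveI : Fact (Nat.Prime 281) := ⟨by norm_num⟩
  have h₁ : Kato.IsKolyvaginPrime ((⟨1, 0, 1, -3, 2⟩ : WeierstrassCurve ℤ).map (Int.castRingHom ℚ)) 7 1 197 :=
    isKolyvaginPrime_of_intModel_of_card intModel 7 1 197 (by norm_num) (by decide +kernel) (by decide) card_197
      (by norm_num)
  have h₂ : Kato.IsKolyvaginPrime ((⟨1, 0, 1, -3, 2⟩ : WeierstrassCurve ℤ).map (Int.castRingHom ℚ)) 7 1 281 :=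
    isKolyvaginPrime_of_intModel_of_card intModel 7 1 281 (by norm_num) (by decide +kernel) (by decide) card_281
      (by norm_num)
  refine ⟨by simpa using isKolyvaginProduct_mul h₁ h₂ (by norm_num), fun ℓ hℓ hdvd ↦ ?_⟩
  rw [show (55357 : ℕ) = 197 * 281 from rfl] at hdvd
  rcases (Nat.Prime.dvd_mul hℓ.out).mp hdvd with h | h
  · obtain rfl := (Nat.prime_dvd_prime_iff_eq hℓ.out (by norm_num)).mp h
    exact card_torsion_le_of_intModel_of_card intModel 7 197 card_197 (by norm_num)
  · obtain rfl := (Nat.prime_dvd_prime_iff_eq hℓ.out (by norm_num)).mp h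
    exact card_torsion_le_of_intModel_of_card intModel 7 281 card_281 (by norm_num)

/-- **`Ш(794a1/ℚ)[7] = 0` FROM THE TREE RECORD `cert_794a1` @ `(7, 197·281)`** (Kurihara currency): granted Kim 2026 Thm. 1.11
(`hKim`), modularity (`hnf`), Mazur 1978 Cor. 4.1 (`hMaz`) BY NAME and the record's CLAIM `hδ` (read at level `N_E` through
`KuriharaCertificates.Record.Claim`), `#Sel_7(E/ℚ) ≤ 7² = 7^rank` and so `Ш(E/ℚ)[7] = 0` (`7` good ordinary `goodOrdinary_7`,
`ρ̄_{E,7}` onto `hasSurjectiveModNGaloisRep_7`, `nonAnomalous_7`, Kodaira–Néron `kodairaNeron_of_five_le 7`, `2 ≤ rank` `KernelCerts002.C794a1.two_le_rank`).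
CONDITIONAL on the three named facts and the claim; per curve; BSD is not proved by it.
[cite: Kim2022StructureSelmer, Thm. 1.11 (PDF p. 8)] [cite: Mazur1978, Cor. 4.1] [cite: CremonaAlgorithms1997, Table 1 (794a1)] -/
theorem sha_inf_torsionBy_eq_bot_of_kuriharaClaim_7
    (hKim : Kim2022_card_selmerGroup_le_pow_of_kuriharaNumber_ne_zero)
    (hnf : exists_isNewformOf) (hMaz : mazur_not_dvd_maninConstant_of_odd)
    (hδ : haveI := isElliptic_c794a1; haveI := isGloballyMinimal_c794a1;
      haveI : NeZero (((⟨1, 0, 1, -3, 2⟩ : WeierstrassCurve ℤ).map (Int.castRingHom ℚ)).conductorNorm ℤ) := neZero_conductorNorm_of_isElliptic _;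
      haveI := Fact.mk (by norm_num : Nat.Prime 7);
      ∀ (D : ModularParametrizationData ((⟨1, 0, 1, -3, 2⟩ : WeierstrassCurve ℤ).map (Int.castRingHom ℚ)) (((⟨1, 0, 1, -3, 2⟩ : WeierstrassCurve ℤ).map (Int.castRingHom ℚ)).conductorNorm ℤ)), ¬ ((7 : ℕ) : ℤ) ∣ D.maninConstant →
        (∃ u : ℚ, ‖(u : ℚ_[7])‖ = 1 ∧ ((⟨1, 0, 1, -3, 2⟩ : WeierstrassCurve ℤ).map (Int.castRingHom ℚ)).realPeriodRat = u * plusPeriod D.f) →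
        ∃ ψ : (ℓ : ℕ) → (ZMod ℓ)ˣ →* Multiplicative (ZMod 7),
          (∀ ℓ ∈ (55357 : ℕ).primeFactors, Function.Surjective (ψ ℓ)) ∧ kuriharaNumber D.f 7 55357 ψ ≠ 0) :
    haveI := isElliptic_c794a1; haveI := isGloballyMinimal_c794a1; haveI := Fact.mk (by norm_num : Nat.Prime 7);
    (((⟨1, 0, 1, -3, 2⟩ : WeierstrassCurve ℤ).map (Int.castRingHom ℚ)).sha ⊓ AddSubgroup.torsionBy ((⟨1, 0, 1, -3, 2⟩ : WeierstrassCurve ℤ).map (Int.castRingHom ℚ)).galH1 ((7 : ℕ) : ℤ) : AddSubgroup _) = ⊥ := by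
  haveI := isElliptic_c794a1
  haveI := isGloballyMinimal_c794a1
  haveI iNZ : NeZero (((⟨1, 0, 1, -3, 2⟩ : WeierstrassCurve ℤ).map (Int.castRingHom ℚ)).conductorNorm ℤ) := neZero_conductorNorm_of_isElliptic _
  haveI := Fact.mk (by norm_num : Nat.Prime 7)
  haveI : NeZero (55357 : ℕ) := ⟨by norm_num⟩
  have hν : (55357 : ℕ).primeFactors.card ≤ ((⟨1, 0, 1, -3, 2⟩ : WeierstrassCurve ℤ).map (Int.castRingHom ℚ)).mordellWeilRank := by
    refine le_trans (le_of_eq ?_) KernelCerts002.C794a1.two_le_rank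
    rw [show (55357 : ℕ) = 197 * 281 from rfl, Nat.primeFactors_mul (by norm_num) (by norm_num),
      Nat.Prime.primeFactors (by norm_num), Nat.Prime.primeFactors (by norm_num)]
    decide
  exact sha_inf_torsionBy_eq_bot_of_kuriharaClaim hKim hnf hMaz _ 7 (by norm_num) goodOrdinary_7.1 goodOrdinary_7.2
    hasSurjectiveModNGaloisRep_7 nonAnomalous_7 (kodairaNeron_of_five_le 7 (by norm_num)) 55357 isCyclicKolyvaginLevel_7_55357 hν hδ

end C794a1

/-! ## `997b1` = `[0, -1, 1, -5, -3]` at `p = 7`: record `cert_997b1` @ `(7, 29·113)`, `δ̃ ≡ 3` -/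

namespace C997b1

/-- `#Ẽ(𝔽_7) = 10` for `997b1` (`a_7 = -2`: good ordinary, non-anomalous at `7`), kernel-decided (`countPointsFast`). [cite: CremonaAlgorithms1997, Table 1 (997b1)] -/
theorem card_7 :
    Nat.card (((⟨0, -1, 1, -5, -3⟩ : WeierstrassCurve ℤ).map (Int.castRingHom (ZMod 7))).toAffine.Point) = 10 :=
  haveI : Fact (Nat.Prime 7) := ⟨by norm_num⟩
  natCard_point_eq_of_countPoints 0 (-1) 1 (-5) (-3) 7 (by norm_num) (by decide +kernel) (n := 10)
    (countPoints_eq_of_fast (by decide +kernel))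

/-- `#Ẽ(𝔽_29) = 28` for `997b1` (`29 ≡ 1`, `a_29 = 2 ≡ 2 (mod 7)`, `7² ∤ 28`), kernel-decided (`countPointsFast`). [cite: CremonaAlgorithms1997, Table 1 (997b1)] -/
theorem card_29 :
    Nat.card (((⟨0, -1, 1, -5, -3⟩ : WeierstrassCurve ℤ).map (Int.castRingHom (ZMod 29))).toAffine.Point) = 28 :=
  haveI : Fact (Nat.Prime 29) := ⟨by norm_num⟩
  natCard_point_eq_of_countPoints 0 (-1) 1 (-5) (-3) 29 (by norm_num) (by decide +kernel) (n := 28)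
    (countPoints_eq_of_fast (by decide +kernel))

/-- `#Ẽ(𝔽_113) = 112` for `997b1` (`113 ≡ 1`, `a_113 = 2 ≡ 2 (mod 7)`, `7² ∤ 112`), kernel-decided (`countPointsFast`). [cite: CremonaAlgorithms1997, Table 1 (997b1)] -/
theorem card_113 :
    Nat.card (((⟨0, -1, 1, -5, -3⟩ : WeierstrassCurve ℤ).map (Int.castRingHom (ZMod 113))).toAffine.Point) = 112 :=
  haveI : Fact (Nat.Prime 113) := ⟨by norm_num⟩
  natCard_point_eq_of_countPoints 0 (-1) 1 (-5) (-3) 113 (by norm_num) (by decide +kernel) (n := 112)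
    (countPoints_eq_of_fast (by decide +kernel))

/-- **`7` is good ordinary for `997b1`** (`7 ∤ Δ`, `a_7 = -2`). [cite: CremonaAlgorithms1997, Table 1 (997b1)] -/
theorem goodOrdinary_7 :
    haveI := Fact.mk (by norm_num : Nat.Prime 7); haveI := isGloballyMinimal_c997b1;
    ((⟨0, -1, 1, -5, -3⟩ : WeierstrassCurve ℤ).map (Int.castRingHom ℚ)).HasGoodReductionAtPrime 7 ∧ ¬ ((7 : ℕ) : ℤ) ∣ ((⟨0, -1, 1, -5, -3⟩ : WeierstrassCurve ℤ).map (Int.castRingHom ℚ)).frobeniusTrace 7 := by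
  haveI := Fact.mk (by norm_num : Nat.Prime 7)
  haveI := isElliptic_c997b1
  haveI := isGloballyMinimal_c997b1
  exact goodOrdinary_of_intModel_certificate intModel 7 (by decide +kernel) (n := 10) card_7 (by decide +kernel)

/-- **`ρ̄_{E,7}` is surjective for `997b1`**: semistable (`gcd(c₄, Δ) = 1`) and `X² − (-4)X + 5` (`a_5 = -4`) has no root
mod `7` (Mazur Prop. 6.3 (1) ⟹ `E[7]` irreducible; Serre Prop. 21 ⟹ onto). [cite: Serre1972, §5.4 Prop. 21] [cite: Mazur1978, §6 Prop. 6.3 (1)] -/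
theorem hasSurjectiveModNGaloisRep_7 :
    haveI := isElliptic_c997b1;
    ((⟨0, -1, 1, -5, -3⟩ : WeierstrassCurve ℤ).map (Int.castRingHom ℚ)).HasSurjectiveModNGaloisRep (7 : ℕ) := by
  have hn : ∀ t : ZMod 7, t ^ 2 - (((5 : ℕ) : ℤ) + 1 - (10 : ℕ) : ℤ) * t + ((5 : ℕ) : ZMod 7) ≠ 0 := by
    decide +kernel
  haveI := Fact.mk (by norm_num : Nat.Prime 7); haveI := Fact.mk (by norm_num : Nat.Prime 5)
  haveI := isElliptic_c997b1; haveI := isGloballyMinimal_c997b1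
  exact hasSurjectiveModNGaloisRep_of_intModel_certificate intModel
    (by rw [Int.isCoprime_iff_gcd_eq_one]; decide +kernel) 7 5 (by norm_num) (by decide +kernel)
    (n := 10) card_5 hn

/-- **`7` is non-anomalous for `997b1`**: `a_7 − 1 = -3`. [cite: SilvermanAEC2009, VII.3 Prop. 3.1] -/
theorem nonAnomalous_7 :
    haveI := isGloballyMinimal_c997b1; haveI := Fact.mk (by norm_num : Nat.Prime 7);
    ¬ ((7 : ℕ) : ℤ) ∣ ((⟨0, -1, 1, -5, -3⟩ : WeierstrassCurve ℤ).map (Int.castRingHom ℚ)).frobeniusTrace 7 - 1 := by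
  haveI := isElliptic_c997b1; haveI := isGloballyMinimal_c997b1; haveI := Fact.mk (by norm_num : Nat.Prime 7)
  rw [IntModel.frobeniusTrace_eq intModel card_7]
  decide

/-- **`3277 = 29·113` is a cyclic Kolyvagin level for `(997b1, 7)`** — the level of the tree record `cert_997b1` at `p = 7`.
[cite: Kim2022StructureSelmer, §1.2.2 (PDF p. 5)] -/
theorem isCyclicKolyvaginLevel_7_3277 :
    haveI := isGloballyMinimal_c997b1; haveI := Fact.mk (by norm_num : Nat.Prime 7);
    IsCyclicKolyvaginLevel ((⟨0, -1, 1, -5, -3⟩ : WeierstrassCurve ℤ).map (Int.castRingHom ℚ)) 7 3277 := by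
  haveI := isElliptic_c997b1
  haveI := isGloballyMinimal_c997b1
  haveI := Fact.mk (by norm_num : Nat.Prime 7)
  haveI : Fact (Nat.Prime 29) := ⟨by norm_num⟩
  haveI : Fact (Nat.Prime 113) := ⟨by norm_num⟩
  have h₁ : Kato.IsKolyvaginPrime ((⟨0, -1, 1, -5, -3⟩ : WeierstrassCurve ℤ).map (Int.castRingHom ℚ)) 7 1 29 :=
    isKolyvaginPrime_of_intModel_of_card intModel 7 1 29 (by norm_num) (by decide +kernel) (by decide) card_29
      (by norm_num)
  have h₂ : Kato.IsKolyvaginPrime ((⟨0, -1, 1, -5, -3⟩ : WeierstrassCurve ℤ).map (Int.castRingHom ℚ)) 7 1 113 :=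
    isKolyvaginPrime_of_intModel_of_card intModel 7 1 113 (by norm_num) (by decide +kernel) (by decide) card_113
      (by norm_num)
  refine ⟨by simpa using isKolyvaginProduct_mul h₁ h₂ (by norm_num), fun ℓ hℓ hdvd ↦ ?_⟩
  rw [show (3277 : ℕ) = 29 * 113 from rfl] at hdvd
  rcases (Nat.Prime.dvd_mul hℓ.out).mp hdvd with h | h
  · obtain rfl := (Nat.prime_dvd_prime_iff_eq hℓ.out (by norm_num)).mp h
    exact card_torsion_le_of_intModel_of_card intModel 7 29 card_29 (by norm_num)
  · obtain rfl := (Nat.prime_dvd_prime_iff_eq hℓ.out (by norm_num)).mp h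
    exact card_torsion_le_of_intModel_of_card intModel 7 113 card_113 (by norm_num)

/-- **`Ш(997b1/ℚ)[7] = 0` FROM THE TREE RECORD `cert_997b1` @ `(7, 29·113)`** (Kurihara currency): granted Kim 2026 Thm. 1.11
(`hKim`), modularity (`hnf`), Mazur 1978 Cor. 4.1 (`hMaz`) BY NAME and the record's CLAIM `hδ` (read at level `N_E` through
`KuriharaCertificates.Record.Claim`), `#Sel_7(E/ℚ) ≤ 7² = 7^rank` and so `Ш(E/ℚ)[7] = 0` (`7` good ordinary `goodOrdinary_7`,
`ρ̄_{E,7}` onto `hasSurjectiveModNGaloisRep_7`, `nonAnomalous_7`, Kodaira–Néron `kodairaNeron_of_five_le 7`, `2 ≤ rank` `KernelCertsR01.C997b1.two_le_rank`).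
CONDITIONAL on the three named facts and the claim; per curve; BSD is not proved by it.
[cite: Kim2022StructureSelmer, Thm. 1.11 (PDF p. 8)] [cite: Mazur1978, Cor. 4.1] [cite: CremonaAlgorithms1997, Table 1 (997b1)] -/
theorem sha_inf_torsionBy_eq_bot_of_kuriharaClaim_7
    (hKim : Kim2022_card_selmerGroup_le_pow_of_kuriharaNumber_ne_zero)
    (hnf : exists_isNewformOf) (hMaz : mazur_not_dvd_maninConstant_of_odd)
    (hδ : haveI := isElliptic_c997b1; haveI := isGloballyMinimal_c997b1;
      haveI : NeZero (((⟨0, -1, 1, -5, -3⟩ : WeierstrassCurve ℤ).map (Int.castRingHom ℚ)).conductorNorm ℤ) := neZero_conductorNorm_of_isElliptic _;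
      haveI := Fact.mk (by norm_num : Nat.Prime 7);
      ∀ (D : ModularParametrizationData ((⟨0, -1, 1, -5, -3⟩ : WeierstrassCurve ℤ).map (Int.castRingHom ℚ)) (((⟨0, -1, 1, -5, -3⟩ : WeierstrassCurve ℤ).map (Int.castRingHom ℚ)).conductorNorm ℤ)), ¬ ((7 : ℕ) : ℤ) ∣ D.maninConstant →
        (∃ u : ℚ, ‖(u : ℚ_[7])‖ = 1 ∧ ((⟨0, -1, 1, -5, -3⟩ : WeierstrassCurve ℤ).map (Int.castRingHom ℚ)).realPeriodRat = u * plusPeriod D.f) →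
        ∃ ψ : (ℓ : ℕ) → (ZMod ℓ)ˣ →* Multiplicative (ZMod 7),
          (∀ ℓ ∈ (3277 : ℕ).primeFactors, Function.Surjective (ψ ℓ)) ∧ kuriharaNumber D.f 7 3277 ψ ≠ 0) :
    haveI := isElliptic_c997b1; haveI := isGloballyMinimal_c997b1; haveI := Fact.mk (by norm_num : Nat.Prime 7);
    (((⟨0, -1, 1, -5, -3⟩ : WeierstrassCurve ℤ).map (Int.castRingHom ℚ)).sha ⊓ AddSubgroup.torsionBy ((⟨0, -1, 1, -5, -3⟩ : WeierstrassCurve ℤ).map (Int.castRingHom ℚ)).galH1 ((7 : ℕ) : ℤ) : AddSubgroup _) = ⊥ := by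
  haveI := isElliptic_c997b1
  haveI := isGloballyMinimal_c997b1
  haveI iNZ : NeZero (((⟨0, -1, 1, -5, -3⟩ : WeierstrassCurve ℤ).map (Int.castRingHom ℚ)).conductorNorm ℤ) := neZero_conductorNorm_of_isElliptic _
  haveI := Fact.mk (by norm_num : Nat.Prime 7)
  haveI : NeZero (3277 : ℕ) := ⟨by norm_num⟩
  have hν : (3277 : ℕ).primeFactors.card ≤ ((⟨0, -1, 1, -5, -3⟩ : WeierstrassCurve ℤ).map (Int.castRingHom ℚ)).mordellWeilRank := by
    refine le_trans (le_of_eq ?_) KernelCertsR01.C997b1.two_le_rank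
    rw [show (3277 : ℕ) = 29 * 113 from rfl, Nat.primeFactors_mul (by norm_num) (by norm_num),
      Nat.Prime.primeFactors (by norm_num), Nat.Prime.primeFactors (by norm_num)]
    decide
  exact sha_inf_torsionBy_eq_bot_of_kuriharaClaim hKim hnf hMaz _ 7 (by norm_num) goodOrdinary_7.1 goodOrdinary_7.2
    hasSurjectiveModNGaloisRep_7 nonAnomalous_7 (kodairaNeron_of_five_le 7 (by norm_num)) 3277 isCyclicKolyvaginLevel_7_3277 hν hδ

end C997b1

end Summit.BirchSwinnertonDyer.BirchSwinnertonDyer.Theorems.KolyvaginDepthDoor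

end
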